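import Mathlib
import Literature.NumberTheory.LFunctions.Zhang2022.Section17MeanSquareMajorant

/-!
# Zhang (2022): the generating functions of `κ`, `κ₁`, `κ₂`, `ν` as `L`-series (`re s > 1`)

Trunk T-ANT (NumberTheory/LFunctions). Y. Zhang, *Discrete mean estimates and the Landau–Siegel
zero*, arXiv:2211.02515v1 (2022) [Zhang2022LandauSiegel], §7 [p. 13 of the source], §15 [p. 30],
§16 [p. 33], §3 [p. 7], with (2.13) [p. 5]. **Status of the source: an unrefereed manuscript, a
claimed result under adjudication** (cell pub-zhang: audit + repair census of arXiv:2211.02515; no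
claim about Landau–Siegel). Companion of `Zhang2022.Section7MeanSquareMajorant`,
`Zhang2022.Section14MeanSquareMajorant`, `Zhang2022.Section17MeanSquareMajorant` (cell ALT seat 3),
whose module docstrings list under "Scope (deliberately NOT here)" what this file PROVES: that the
coefficient sequences DEFINED there as Dirichlet convolutions (`kappa`, `kappa₁`, `kappa₂`, `nuChi`,
and the convolution `conv κ a`) have the generating functions by which the source DEFINES its `κ`,
`κ₁`, `κ₂`, `ν` and `(κ ∗ a₁)(m)ψ(m)`.

The source's definitions are Dirichlet-series identities on `σ > 1`, verbatim:

> [§7, p. 13] Let `κ(n)` be given by `∑_n κ(n)/n^s = ζ(s+β₁)ζ(s+β₂)ζ(s+β₃)/ζ(s)`, and regard `a₁`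
> as an arithmetic function. For `σ > 1`,
> `(L(s+β₁,ψ)L(s+β₂,ψ)L(s+β₃,ψ)/L(s,ψ)) A(a₁;s,ψ) = ∑_m (κ∗a₁)(m)ψ(m)/m^s`.
> [§15, p. 30] Let `κ₁(m)` be given by `ζ(s+β₁)ζ(s+β₂)/ζ(s) = ∑_m κ₁(m)/m^s`, `σ > 1`. Regarding
> `b` as an arithmetic function, for `σ > 1` we have
> `L(s+β₁,ψ)L(s+β₂,ψ)B(s,ψ)/L(s,ψ) = ∑_m (κ₁∗b)(m)ψ(m)/m^s`.
> [§16, p. 33] Let `κ₂(n)` … be given by `∑_n κ₂(n)/n^s = ζ(s+β₁)/ζ(s)`, `σ > 1`.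
> [§3, p. 7] Let `ν(n)` … be given by `ζ(s)L(s,χ) = ∑_n ν(n)/n^s`, …, `σ > 1`.

Here `β_j = i b_j` are PURELY IMAGINARY ((2.13): `β₁ = iα(1 − 5c′α𝓛)`, `β₂ = 2iα(1 + c′α𝓛)`,
`β₃ = 3iα(1 − c′α𝓛)`), `A(a₁;s,ψ) = ∑_n a₁(n)ψ(n)n^{-s}`, `B(s,ψ) = ∑_n b(n)ψ(n)n^{-s}`, and
`ζ(s + ib)` has coefficients `n^{-ib}` (`powI b`). The companions define
`kappa b₁ b₂ b₃ = powI b₁ ∗ powI b₂ ∗ powI b₃ ∗ μ`, `kappa₁ b₁ b₂ = powI b₁ ∗ powI b₂ ∗ μ`,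
`kappa₂ b₁ = powI b₁ ∗ μ`, `nuChi χ = χ ∗ 𝟙`, `conv κ a = κ ∗ a`. This file proves, for `1 < re s`:

* `LSeries_powI` — `∑_{n≥1} n^{-ib} n^{-s} = ζ(s + ib)`, and its twist `LSeries_mul_powI`
  (`∑ f(n) n^{-ib} n^{-s} = ∑ f(n) n^{-(s+ib)}`, every `s`);
* `LSeries_moebius_complex` — `∑ μ(n) n^{-s} = ζ(s)⁻¹` (Mathlib's `LSeries_one_mul_Lseries_moebius`);
* `LSeries_kappa` — **`∑ κ(n) n^{-s} = ζ(s+ib₁)ζ(s+ib₂)ζ(s+ib₃)/ζ(s)`**; `LSeries_kappa₁` —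
  `∑ κ₁(n) n^{-s} = ζ(s+ib₁)ζ(s+ib₂)/ζ(s)`; `LSeries_kappa₂` — `∑ κ₂(n) n^{-s} = ζ(s+ib₁)/ζ(s)`;
* `LSeries_nuChi` — `∑ ν(n) n^{-s} = ζ(s) · ∑ χ(n) n^{-s}` for any bounded `χ : ℕ → ℝ`;
* the twisted forms with a Dirichlet character `ψ` (twisting by the completely multiplicative `ψ`
  commutes with Dirichlet convolution — Mathlib's `DirichletCharacter.mul_convolution_distrib`):
  `LSeries_twist_kappa` — `∑ κ(n)ψ(n) n^{-s} = L(s+ib₁,ψ)L(s+ib₂,ψ)L(s+ib₃,ψ)/L(s,ψ)`, and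
  **`LSeries_twist_conv_kappa`** — the display of [p. 13]:
  `∑_m (κ∗a)(m)ψ(m) m^{-s} = (L(s+ib₁,ψ)L(s+ib₂,ψ)L(s+ib₃,ψ)/L(s,ψ)) · ∑_n a(n)ψ(n)n^{-s}`;
  `LSeries_twist_conv_kappa₁` — the display of [p. 30]; `LSeries_twist_conv_kappa₂` — its §16 twin;
* the summability statements used on the way.

So the objects whose logarithmic mean squares the companions bound ((7.5), (15.5), (16.1), §17) ARE
the source's `κ`, `κ₁`, `κ₂`, `ν`, `κ ∗ a₁`, `κ₁ ∗ b`, `κ₂ ∗ b₁` in the only sense the source gives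
them (Dirichlet coefficients on `σ > 1`). Method: Mathlib's `LSeries_convolution'` / `LSeries_mul'`
(the `L`-series of a Dirichlet convolution is the product of the `L`-series under absolute
convergence), `LSeries_one_eq_riemannZeta`, `LSeries_one_mul_Lseries_moebius`,
`DirichletCharacter.LSeries.mul_mu_eq_one`, and the termwise shift `n^{-ib}/n^s = 1/n^{s+ib}`
(`Complex.cpow_add`, `n ≠ 0`). [folklore]

Scope (deliberately NOT here): anything at `re s ≤ 1` (the source USES the sequences at `σ = 1/2`
inside FINITE sums `m < P²`, where no `L`-series identity is needed or claimed; the companions'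
bounds are stated for those finite sums); the numerical values of `b_j` from (2.13)/(2.10); the
finite Dirichlet polynomials `A`, `B`, `N`, `K` of the source as such (here `a`, `b` are arbitrary
sequences with absolutely convergent twisted `L`-series at `s`, which finitely supported or bounded
sequences are); and anything bearing on the cell's verdict on (8.24)/(2.32)
(`Section8Certificate.not_ineq824`). No statement about Theorems 1–2 of the source is made or implied.

## References

* Y. Zhang, *Discrete mean estimates and the Landau–Siegel zero*, arXiv:2211.02515v1 (2022): §7
  p. 13 (definition of `κ`, the twisted display), §15 p. 30 (definition of `κ₁`, the twisted
  display), §16 p. 33 (definition of `κ₂`), §3 p. 7 (definition of `ν`), (2.13) p. 5.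
  [cite: Zhang2022LandauSiegel, §7 p. 13]
* E. C. Titchmarsh, *The Theory of the Riemann Zeta-Function*, 2nd ed. (OUP 1986), §1.1 (1.1.4)
  (`∑ μ(n) n^{-s} = 1/ζ(s)`), §1.2. [cite: Titchmarsh1986, §1.1 (1.1.4)]
-/

noncomputable section

open Complex LSeries ArithmeticFunction
open scoped LSeries.notation ArithmeticFunction.Moebius

namespace Literature.NumberTheory.LFunctions.Zhang2022.MeanSquareMajorant

/-! ### Part 1. The shift: `n^{-ib}` are the coefficients of `ζ(s + ib)` -/

/-- `re (s + ib) = re s` for real `b`. [folklore] -/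
theorem add_mul_I_re (s : ℂ) (b : ℝ) : (s + b * I).re = s.re := by simp

/-- Termwise shift: `f(n) n^{-ib} / n^s = f(n) / n^{s+ib}` (`n ≥ 1`; both sides `0` at `n = 0`).
[folklore] -/
theorem term_mul_powI (f : ℕ → ℂ) (b : ℝ) (s : ℂ) (n : ℕ) :
    term (f * ↗(powI b)) s n = term f (s + b * I) n := by
  rcases eq_or_ne n 0 with rfl | hn
  · simp
  have hn' : (n : ℂ) ≠ 0 := Nat.cast_ne_zero.mpr hn
  simp only [term_of_ne_zero hn, Pi.mul_apply, powI_apply_of_ne_zero b hn]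
  rw [cpow_neg, cpow_add _ _ hn', ← div_eq_mul_inv, div_div, mul_comm ((n : ℂ) ^ ((b : ℂ) * I))]

/-- **Twisted shift**: `∑_{n≥1} f(n) n^{-ib} n^{-s} = ∑_{n≥1} f(n) n^{-(s+ib)}` for every `f` and
every `s` (an identity of the series term by term, convergent or not). [folklore] -/
theorem LSeries_mul_powI (f : ℕ → ℂ) (b : ℝ) (s : ℂ) :
    L (f * ↗(powI b)) s = L f (s + b * I) := by
  unfold LSeries
  exact tsum_congr fun n => term_mul_powI f b s n

/-- Summability of the twisted shift: at `s` iff `f` is `L`-summable at `s + ib`. [folklore] -/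
theorem LSeriesSummable_mul_powI_iff (f : ℕ → ℂ) (b : ℝ) (s : ℂ) :
    LSeriesSummable (f * ↗(powI b)) s ↔ LSeriesSummable f (s + b * I) := by
  unfold LSeriesSummable
  rw [show term (f * ↗(powI b)) s = term f (s + b * I) from funext (term_mul_powI f b s)]

/-- `∑_{n≥1} n^{-ib} n^{-s} = ∑_{n≥1} n^{-(s+ib)}` (every `s`). [folklore] -/
theorem LSeries_powI_eq (b : ℝ) (s : ℂ) : L ↗(powI b) s = L 1 (s + b * I) := by
  have h := LSeries_mul_powI 1 b s
  rwa [one_mul] at h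

/-- `∑ n^{-ib} n^{-s}` converges absolutely iff `re s > 1`. [folklore] -/
theorem LSeriesSummable_powI_iff (b : ℝ) (s : ℂ) : LSeriesSummable ↗(powI b) s ↔ 1 < s.re := by
  have h := LSeriesSummable_mul_powI_iff 1 b s
  rw [one_mul] at h
  rw [h, LSeriesSummable_one_iff, add_mul_I_re]

/-- **`∑_{n≥1} n^{-ib} n^{-s} = ζ(s + ib)`** for `re s > 1`: `powI b` is the coefficient sequence of
`ζ(s + β)`, `β = ib`. [folklore] -/
theorem LSeries_powI (b : ℝ) {s : ℂ} (hs : 1 < s.re) : L ↗(powI b) s = riemannZeta (s + b * I) := by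
  rw [LSeries_powI_eq, LSeries_one_eq_riemannZeta (by rwa [add_mul_I_re])]

/-- Twisted: `∑_{n≥1} ψ(n) n^{-ib} n^{-s} = L(s + ib, ψ)` (as `L`-series; every `s`). [folklore] -/
theorem LSeries_twist_powI {N : ℕ} (ψ : DirichletCharacter ℂ N) (b : ℝ) (s : ℂ) :
    L (↗ψ * ↗(powI b)) s = L ↗ψ (s + b * I) :=
  LSeries_mul_powI _ b s

/-- Twisted summability: `∑ ψ(n) n^{-ib} n^{-s}` converges absolutely for `re s > 1`. [folklore] -/
theorem LSeriesSummable_twist_powI {N : ℕ} (ψ : DirichletCharacter ℂ N) (b : ℝ) {s : ℂ}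
    (hs : 1 < s.re) : LSeriesSummable (↗ψ * ↗(powI b)) s :=
  (LSeriesSummable_mul_powI_iff _ b s).mpr (ψ.LSeriesSummable_of_one_lt_re (by rwa [add_mul_I_re]))

/-! ### Part 2. The Möbius factor: `∑ μ(n) n^{-s} = 1/ζ(s)` -/

/-- The complex-valued Möbius arithmetic function of the companions is Mathlib's `↗μ`. [folklore] -/
theorem coe_moebius_complex : ↗(ArithmeticFunction.moebius : ArithmeticFunction ℂ) = ↗μ :=
  funext fun _ => rfl

/-- `∑ μ(n) n^{-s}` converges absolutely for `re s > 1`. [folklore] -/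
theorem LSeriesSummable_moebius_complex {s : ℂ} (hs : 1 < s.re) :
    LSeriesSummable ↗(ArithmeticFunction.moebius : ArithmeticFunction ℂ) s := by
  rw [coe_moebius_complex]
  exact LSeriesSummable_moebius_iff.mpr hs

/-- **`∑ μ(n) n^{-s} = ζ(s)⁻¹`** for `re s > 1`. [cite: Titchmarsh1986, §1.1 (1.1.4)] -/
theorem LSeries_moebius_complex {s : ℂ} (hs : 1 < s.re) :
    L ↗(ArithmeticFunction.moebius : ArithmeticFunction ℂ) s = (riemannZeta s)⁻¹ := by
  rw [coe_moebius_complex]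
  have h := LSeries_one_mul_Lseries_moebius hs
  rw [LSeries_one_eq_riemannZeta hs] at h
  exact eq_inv_of_mul_eq_one_right h

/-- Twisted: `∑ μ(n)ψ(n) n^{-s}` converges absolutely for `re s > 1`. [folklore] -/
theorem LSeriesSummable_twist_moebius_complex {N : ℕ} (ψ : DirichletCharacter ℂ N) {s : ℂ}
    (hs : 1 < s.re) :
    LSeriesSummable (↗ψ * ↗(ArithmeticFunction.moebius : ArithmeticFunction ℂ)) s := by
  rw [coe_moebius_complex]
  exact ψ.LSeriesSummable_mul (LSeriesSummable_moebius_iff.mpr hs)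

/-- Twisted: **`∑ μ(n)ψ(n) n^{-s} = L(s,ψ)⁻¹`** for `re s > 1` (Mathlib's
`DirichletCharacter.LSeries.mul_mu_eq_one`). [folklore] -/
theorem LSeries_twist_moebius_complex {N : ℕ} (ψ : DirichletCharacter ℂ N) {s : ℂ}
    (hs : 1 < s.re) :
    L (↗ψ * ↗(ArithmeticFunction.moebius : ArithmeticFunction ℂ)) s = (L ↗ψ s)⁻¹ := by
  rw [coe_moebius_complex]
  exact eq_inv_of_mul_eq_one_right (DirichletCharacter.LSeries.mul_mu_eq_one ψ hs)

/-! ### Part 3. Twisting by `ψ` commutes with Dirichlet convolution -/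

/-- The companions' `conv κ a` is Mathlib's Dirichlet convolution `κ ⍟ a`. [folklore] -/
theorem conv_eq_convolution (κ : ArithmeticFunction ℂ) (a : ℕ → ℂ) : conv κ a = ↗κ ⍟ a := by
  funext m
  rw [LSeries.convolution_def]
  rfl

/-- `∑ (κ ∗ a)(m) m^{-s} = (∑ κ(n) n^{-s}) (∑ a(n) n^{-s})` under absolute convergence. [folklore] -/
theorem LSeries_conv (κ : ArithmeticFunction ℂ) (a : ℕ → ℂ) {s : ℂ} (hκ : LSeriesSummable ↗κ s)
    (ha : LSeriesSummable a s) : L (conv κ a) s = L ↗κ s * L a s := by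
  rw [conv_eq_convolution, LSeries_convolution' hκ ha]

/-- `ψ · (f ∗ g) = (ψ·f) ∗ (ψ·g)` for arithmetic functions `f`, `g` (twisting by a completely
multiplicative `ψ` distributes over Dirichlet convolution). [folklore] -/
theorem twist_coe_mul {N : ℕ} (ψ : DirichletCharacter ℂ N) (f g : ArithmeticFunction ℂ) :
    ↗ψ * ↗(f * g) = (↗ψ * ↗f) ⍟ (↗ψ * ↗g) := by
  rw [DirichletCharacter.mul_convolution_distrib, ArithmeticFunction.coe_mul]

/-- `ψ · (κ ∗ a) = (ψ·κ) ∗ (ψ·a)`. [folklore] -/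
theorem twist_conv {N : ℕ} (ψ : DirichletCharacter ℂ N) (κ : ArithmeticFunction ℂ) (a : ℕ → ℂ) :
    ↗ψ * conv κ a = (↗ψ * ↗κ) ⍟ (↗ψ * a) := by
  rw [DirichletCharacter.mul_convolution_distrib, conv_eq_convolution]

/-- Twisted product rule: `∑ (f∗g)(n)ψ(n) n^{-s} = (∑ f(n)ψ(n)n^{-s})(∑ g(n)ψ(n)n^{-s})` under
absolute convergence of the two factors. [folklore] -/
theorem LSeries_twist_mul {N : ℕ} (ψ : DirichletCharacter ℂ N) (f g : ArithmeticFunction ℂ)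
    {s : ℂ} (hf : LSeriesSummable (↗ψ * ↗f) s) (hg : LSeriesSummable (↗ψ * ↗g) s) :
    L (↗ψ * ↗(f * g)) s = L (↗ψ * ↗f) s * L (↗ψ * ↗g) s := by
  rw [twist_coe_mul, LSeries_convolution' hf hg]

/-- Summability of the twisted product. [folklore] -/
theorem LSeriesSummable_twist_mul {N : ℕ} (ψ : DirichletCharacter ℂ N) (f g : ArithmeticFunction ℂ)
    {s : ℂ} (hf : LSeriesSummable (↗ψ * ↗f) s) (hg : LSeriesSummable (↗ψ * ↗g) s) :
    LSeriesSummable (↗ψ * ↗(f * g)) s := by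
  rw [twist_coe_mul]
  exact hf.convolution hg

/-- Twisted convolution with a sequence: `∑ (κ ∗ a)(m)ψ(m) m^{-s} =
(∑ κ(n)ψ(n)n^{-s})(∑ a(n)ψ(n)n^{-s})` under absolute convergence of the two factors. [folklore] -/
theorem LSeries_twist_conv {N : ℕ} (ψ : DirichletCharacter ℂ N) (κ : ArithmeticFunction ℂ)
    (a : ℕ → ℂ) {s : ℂ} (hκ : LSeriesSummable (↗ψ * ↗κ) s) (ha : LSeriesSummable (↗ψ * a) s) :
    L (↗ψ * conv κ a) s = L (↗ψ * ↗κ) s * L (↗ψ * a) s := by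
  rw [twist_conv, LSeries_convolution' hκ ha]

/-! ### Part 4. `κ`, `κ₁`, `κ₂`: the source's definitions [pp. 13, 30, 33] -/

section Kappa

variable (b₁ b₂ b₃ : ℝ) {s : ℂ}

/-- `∑ κ(n) n^{-s}` converges absolutely for `re s > 1`. [folklore] -/
theorem LSeriesSummable_kappa (hs : 1 < s.re) : LSeriesSummable ↗(kappa b₁ b₂ b₃) s := by
  unfold kappa
  exact LSeriesSummable_mul (LSeriesSummable_mul (LSeriesSummable_mul
    ((LSeriesSummable_powI_iff b₁ s).mpr hs) ((LSeriesSummable_powI_iff b₂ s).mpr hs))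
    ((LSeriesSummable_powI_iff b₃ s).mpr hs)) (LSeriesSummable_moebius_complex hs)

/-- **Zhang's definition of `κ`** [p. 13]: `∑_n κ(n) n^{-s} = ζ(s+β₁)ζ(s+β₂)ζ(s+β₃)/ζ(s)`,
`β_j = i b_j`, `σ > 1` — satisfied by the companions' `kappa b₁ b₂ b₃ = powI b₁ ∗ powI b₂ ∗ powI b₃ ∗ μ`.
[cite: Zhang2022LandauSiegel, §7 p. 13 (definition of κ)] -/
theorem LSeries_kappa (hs : 1 < s.re) :
    L ↗(kappa b₁ b₂ b₃) s =
      riemannZeta (s + b₁ * I) * riemannZeta (s + b₂ * I) * riemannZeta (s + b₃ * I) /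
        riemannZeta s := by
  have h1 := (LSeriesSummable_powI_iff b₁ s).mpr hs
  have h2 := (LSeriesSummable_powI_iff b₂ s).mpr hs
  have h3 := (LSeriesSummable_powI_iff b₃ s).mpr hs
  unfold kappa
  rw [LSeries_mul' (LSeriesSummable_mul (LSeriesSummable_mul h1 h2) h3)
      (LSeriesSummable_moebius_complex hs),
    LSeries_mul' (LSeriesSummable_mul h1 h2) h3, LSeries_mul' h1 h2, LSeries_powI b₁ hs,
    LSeries_powI b₂ hs, LSeries_powI b₃ hs, LSeries_moebius_complex hs, div_eq_mul_inv]

/-- Cleared form: `(∑ κ(n) n^{-s}) ζ(s) = ζ(s+ib₁)ζ(s+ib₂)ζ(s+ib₃)` (`re s > 1`, where `ζ(s) ≠ 0`).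
[cite: Zhang2022LandauSiegel, §7 p. 13 (definition of κ)] -/
theorem LSeries_kappa_mul_riemannZeta (hs : 1 < s.re) :
    L ↗(kappa b₁ b₂ b₃) s * riemannZeta s =
      riemannZeta (s + b₁ * I) * riemannZeta (s + b₂ * I) * riemannZeta (s + b₃ * I) := by
  rw [LSeries_kappa b₁ b₂ b₃ hs, div_mul_cancel₀ _ (riemannZeta_ne_zero_of_one_lt_re hs)]

/-- `∑ κ₁(n) n^{-s}` converges absolutely for `re s > 1`. [folklore] -/
theorem LSeriesSummable_kappa₁ (hs : 1 < s.re) : LSeriesSummable ↗(kappa₁ b₁ b₂) s := by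
  unfold kappa₁
  exact LSeriesSummable_mul (LSeriesSummable_mul ((LSeriesSummable_powI_iff b₁ s).mpr hs)
    ((LSeriesSummable_powI_iff b₂ s).mpr hs)) (LSeriesSummable_moebius_complex hs)

/-- **Zhang's definition of `κ₁`** [p. 30]: `ζ(s+β₁)ζ(s+β₂)/ζ(s) = ∑_m κ₁(m) m^{-s}`, `σ > 1` —
satisfied by the companions' `kappa₁ b₁ b₂ = powI b₁ ∗ powI b₂ ∗ μ`.
[cite: Zhang2022LandauSiegel, §15 p. 30 (definition of κ₁)] -/
theorem LSeries_kappa₁ (hs : 1 < s.re) :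
    L ↗(kappa₁ b₁ b₂) s = riemannZeta (s + b₁ * I) * riemannZeta (s + b₂ * I) / riemannZeta s := by
  have h1 := (LSeriesSummable_powI_iff b₁ s).mpr hs
  have h2 := (LSeriesSummable_powI_iff b₂ s).mpr hs
  unfold kappa₁
  rw [LSeries_mul' (LSeriesSummable_mul h1 h2) (LSeriesSummable_moebius_complex hs),
    LSeries_mul' h1 h2, LSeries_powI b₁ hs, LSeries_powI b₂ hs, LSeries_moebius_complex hs,
    div_eq_mul_inv]

/-- `∑ κ₂(n) n^{-s}` converges absolutely for `re s > 1`. [folklore] -/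
theorem LSeriesSummable_kappa₂ (hs : 1 < s.re) : LSeriesSummable ↗(kappa₂ b₁) s := by
  unfold kappa₂
  exact LSeriesSummable_mul ((LSeriesSummable_powI_iff b₁ s).mpr hs)
    (LSeriesSummable_moebius_complex hs)

/-- **Zhang's definition of `κ₂`** [p. 33]: `∑_n κ₂(n) n^{-s} = ζ(s+β₁)/ζ(s)`, `σ > 1` — satisfied
by the companions' `kappa₂ b₁ = powI b₁ ∗ μ`. [cite: Zhang2022LandauSiegel, §16 p. 33 (definition of κ₂)] -/
theorem LSeries_kappa₂ (hs : 1 < s.re) :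
    L ↗(kappa₂ b₁) s = riemannZeta (s + b₁ * I) / riemannZeta s := by
  unfold kappa₂
  rw [LSeries_mul' ((LSeriesSummable_powI_iff b₁ s).mpr hs) (LSeriesSummable_moebius_complex hs),
    LSeries_powI b₁ hs, LSeries_moebius_complex hs, div_eq_mul_inv]

/-! ### Part 5. The twisted displays of [p. 13] and [p. 30] -/

variable {N : ℕ} (ψ : DirichletCharacter ℂ N)

/-- `∑ κ(n)ψ(n) n^{-s}` converges absolutely for `re s > 1`. [folklore] -/
theorem LSeriesSummable_twist_kappa (hs : 1 < s.re) :
    LSeriesSummable (↗ψ * ↗(kappa b₁ b₂ b₃)) s :=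
  ψ.LSeriesSummable_mul (LSeriesSummable_kappa b₁ b₂ b₃ hs)

/-- `∑ κ(n)ψ(n) n^{-s} = L(s+ib₁,ψ)L(s+ib₂,ψ)L(s+ib₃,ψ)/L(s,ψ)` for `re s > 1` (the source's
`L(s,ψ)` on `σ > 1` is the `L`-series `∑ ψ(n)n^{-s}`). [cite: Zhang2022LandauSiegel, §7 p. 13] -/
theorem LSeries_twist_kappa (hs : 1 < s.re) :
    L (↗ψ * ↗(kappa b₁ b₂ b₃)) s =
      L ↗ψ (s + b₁ * I) * L ↗ψ (s + b₂ * I) * L ↗ψ (s + b₃ * I) / L ↗ψ s := by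
  have h1 := LSeriesSummable_twist_powI ψ b₁ hs
  have h2 := LSeriesSummable_twist_powI ψ b₂ hs
  have h3 := LSeriesSummable_twist_powI ψ b₃ hs
  unfold kappa
  rw [LSeries_twist_mul ψ _ _ (LSeriesSummable_twist_mul ψ _ _ (LSeriesSummable_twist_mul ψ _ _
      h1 h2) h3) (LSeriesSummable_twist_moebius_complex ψ hs),
    LSeries_twist_mul ψ _ _ (LSeriesSummable_twist_mul ψ _ _ h1 h2) h3,
    LSeries_twist_mul ψ _ _ h1 h2, LSeries_twist_powI, LSeries_twist_powI, LSeries_twist_powI,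
    LSeries_twist_moebius_complex ψ hs, div_eq_mul_inv]

/-- **The display of [p. 13]** ("regard `a₁` as an arithmetic function. For `σ > 1`,
`(L(s+β₁,ψ)L(s+β₂,ψ)L(s+β₃,ψ)/L(s,ψ)) A(a₁;s,ψ) = ∑_m (κ∗a₁)(m)ψ(m)/m^s`"): for `re s > 1` and
any `a` with `∑ a(n)ψ(n)n^{-s}` absolutely convergent (e.g. `a` bounded or finitely supported),
`∑_m (κ∗a)(m)ψ(m) m^{-s} = (L(s+ib₁,ψ)L(s+ib₂,ψ)L(s+ib₃,ψ)/L(s,ψ)) · ∑_n a(n)ψ(n)n^{-s}` — with the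
companions' `conv (kappa b₁ b₂ b₃) a` for `κ ∗ a`, the sequence whose mean square (7.5) bounds.
[cite: Zhang2022LandauSiegel, §7 p. 13 (display after the definition of κ)] -/
theorem LSeries_twist_conv_kappa {a : ℕ → ℂ} (hs : 1 < s.re) (ha : LSeriesSummable (↗ψ * a) s) :
    L (↗ψ * conv (kappa b₁ b₂ b₃) a) s =
      L ↗ψ (s + b₁ * I) * L ↗ψ (s + b₂ * I) * L ↗ψ (s + b₃ * I) / L ↗ψ s * L (↗ψ * a) s := by
  rw [LSeries_twist_conv ψ _ a (LSeriesSummable_twist_kappa b₁ b₂ b₃ ψ hs) ha,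
    LSeries_twist_kappa b₁ b₂ b₃ ψ hs]

/-- `∑ κ₁(n)ψ(n) n^{-s} = L(s+ib₁,ψ)L(s+ib₂,ψ)/L(s,ψ)` for `re s > 1`.
[cite: Zhang2022LandauSiegel, §15 p. 30] -/
theorem LSeries_twist_kappa₁ (hs : 1 < s.re) :
    L (↗ψ * ↗(kappa₁ b₁ b₂)) s = L ↗ψ (s + b₁ * I) * L ↗ψ (s + b₂ * I) / L ↗ψ s := by
  have h1 := LSeriesSummable_twist_powI ψ b₁ hs
  have h2 := LSeriesSummable_twist_powI ψ b₂ hs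
  unfold kappa₁
  rw [LSeries_twist_mul ψ _ _ (LSeriesSummable_twist_mul ψ _ _ h1 h2)
      (LSeriesSummable_twist_moebius_complex ψ hs),
    LSeries_twist_mul ψ _ _ h1 h2, LSeries_twist_powI, LSeries_twist_powI,
    LSeries_twist_moebius_complex ψ hs, div_eq_mul_inv]

/-- **The display of [p. 30]** ("Regarding `b` as an arithmetic function, for `σ > 1` we have
`L(s+β₁,ψ)L(s+β₂,ψ)B(s,ψ)/L(s,ψ) = ∑_m (κ₁∗b)(m)ψ(m)/m^s`", `B(s,ψ) = ∑_n b(n)ψ(n)n^{-s}`): for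
`re s > 1` and `∑ b(n)ψ(n)n^{-s}` absolutely convergent,
`∑_m (κ₁∗b)(m)ψ(m) m^{-s} = (L(s+ib₁,ψ)L(s+ib₂,ψ)/L(s,ψ)) · ∑_n b(n)ψ(n)n^{-s}` — with the companions'
`conv (kappa₁ b₁ b₂) b`, the sequence whose mean square (15.5) bounds.
[cite: Zhang2022LandauSiegel, §15 p. 30 (display after the definition of κ₁)] -/
theorem LSeries_twist_conv_kappa₁ {b : ℕ → ℂ} (hs : 1 < s.re) (hb : LSeriesSummable (↗ψ * b) s) :
    L (↗ψ * conv (kappa₁ b₁ b₂) b) s =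
      L ↗ψ (s + b₁ * I) * L ↗ψ (s + b₂ * I) / L ↗ψ s * L (↗ψ * b) s := by
  rw [LSeries_twist_conv ψ _ b (ψ.LSeriesSummable_mul (LSeriesSummable_kappa₁ b₁ b₂ hs)) hb,
    LSeries_twist_kappa₁ b₁ b₂ ψ hs]

/-- `∑ κ₂(n)ψ(n) n^{-s} = L(s+ib₁,ψ)/L(s,ψ)` for `re s > 1`. [cite: Zhang2022LandauSiegel, §16 p. 33] -/
theorem LSeries_twist_kappa₂ (hs : 1 < s.re) :
    L (↗ψ * ↗(kappa₂ b₁)) s = L ↗ψ (s + b₁ * I) / L ↗ψ s := by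
  unfold kappa₂
  rw [LSeries_twist_mul ψ _ _ (LSeriesSummable_twist_powI ψ b₁ hs)
      (LSeriesSummable_twist_moebius_complex ψ hs),
    LSeries_twist_powI, LSeries_twist_moebius_complex ψ hs, div_eq_mul_inv]

/-- The §16 twin (`κ₂* = κ₂ ∗ b₁` [p. 33]): for `re s > 1` and `∑ b₁(n)ψ(n)n^{-s}` absolutely
convergent, `∑_m (κ₂∗b₁)(m)ψ(m) m^{-s} = (L(s+ib₁,ψ)/L(s,ψ)) · ∑_n b₁(n)ψ(n)n^{-s}` — with the
companions' `conv (kappa₂ b₁) c`, the sequence whose mean square (16.1) bounds.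
[cite: Zhang2022LandauSiegel, §16 p. 33] -/
theorem LSeries_twist_conv_kappa₂ {c : ℕ → ℂ} (hs : 1 < s.re) (hc : LSeriesSummable (↗ψ * c) s) :
    L (↗ψ * conv (kappa₂ b₁) c) s = L ↗ψ (s + b₁ * I) / L ↗ψ s * L (↗ψ * c) s := by
  rw [LSeries_twist_conv ψ _ c (ψ.LSeriesSummable_mul (LSeriesSummable_kappa₂ b₁ hs)) hc,
    LSeries_twist_kappa₂ b₁ ψ hs]

end Kappa

/-! ### Part 6. `ν = χ ∗ 𝟙`: the source's definition [p. 7] -/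

section Nu

variable {χ : ℕ → ℝ}

/-- `(c ∗ 𝟙)(n) = ∑_{d ∣ n} c(d)`. [folklore] -/
theorem convolution_one_apply (c : ℕ → ℂ) (n : ℕ) : (c ⍟ 1) n = ∑ d ∈ n.divisors, c d := by
  simp only [LSeries.convolution_def, Pi.one_apply, mul_one]
  exact Nat.sum_divisorsAntidiagonal fun i _ => c i

/-- The companions' `nuChi χ` (real-valued), read in `ℂ`, is the Dirichlet convolution `χ ∗ 𝟙`.
[folklore] -/
theorem coe_nuChi_eq_convolution (χ : ℕ → ℝ) :
    (fun n => (nuChi χ n : ℂ)) = (fun n => (chiAF χ n : ℂ)) ⍟ 1 := by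
  funext n
  rw [convolution_one_apply, nuChi_apply, Complex.ofReal_sum]

/-- A bounded `χ` has absolutely convergent `L`-series for `re s > 1` (read through `chiAF χ`,
which is `χ` off `n = 0`). [folklore] -/
theorem LSeriesSummable_chiAF {M : ℝ} (hχ : ∀ n, n ≠ 0 → |χ n| ≤ M) {s : ℂ} (hs : 1 < s.re) :
    LSeriesSummable (fun n => (chiAF χ n : ℂ)) s :=
  LSeriesSummable_of_bounded_of_one_lt_re (m := M)
    (fun n hn => by rw [chiAF_apply_of_ne_zero χ hn, Complex.norm_real, Real.norm_eq_abs]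
                    exact hχ n hn) hs

/-- **Zhang's definition of `ν`** [p. 7]: `ζ(s)L(s,χ) = ∑_n ν(n) n^{-s}`, `σ > 1` — satisfied by the
companions' `nuChi χ = χ ∗ 𝟙` for every bounded `χ : ℕ → ℝ` (the source's `χ` is a real primitive
character, `|χ| ≤ 1`), with `L(s,χ)` the `L`-series `∑ χ(n)n^{-s}`.
[cite: Zhang2022LandauSiegel, §3 p. 7 (definition of ν)] -/
theorem LSeries_nuChi {M : ℝ} (hχ : ∀ n, n ≠ 0 → |χ n| ≤ M) {s : ℂ} (hs : 1 < s.re) :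
    L (fun n => (nuChi χ n : ℂ)) s = riemannZeta s * L (fun n => (χ n : ℂ)) s := by
  have hcongr : L (fun n => (chiAF χ n : ℂ)) s = L (fun n => (χ n : ℂ)) s :=
    LSeries_congr (fun hn => by rw [chiAF_apply_of_ne_zero χ hn]) s
  rw [coe_nuChi_eq_convolution, LSeries_convolution' (LSeriesSummable_chiAF hχ hs)
      (LSeriesSummable_one_iff.mpr hs), LSeries_one_eq_riemannZeta hs, hcongr, mul_comm]

/-- `∑ ν(n) n^{-s}` converges absolutely for `re s > 1` (`χ` bounded). [folklore] -/
theorem LSeriesSummable_nuChi {M : ℝ} (hχ : ∀ n, n ≠ 0 → |χ n| ≤ M) {s : ℂ} (hs : 1 < s.re) :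
    LSeriesSummable (fun n => (nuChi χ n : ℂ)) s := by
  rw [coe_nuChi_eq_convolution]
  exact (LSeriesSummable_chiAF hχ hs).convolution (LSeriesSummable_one_iff.mpr hs)

end Nu

end Literature.NumberTheory.LFunctions.Zhang2022.MeanSquareMajorant
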